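import Summits.QuantumFields.BalabanUV.Beta.D1BFx.CoframeJetDipole

/-!
# `BalabanUV.Beta.D1BFx.CoframeJetDipoleMass` — road «BF-x» for BINDER row D1, slot (K), binder (C1) «TB4-W CO-FRAME FIRST JET,
# m-UNIFORM MASS»: THE REDUCTION OF PART 14's (C1) ROW AT ONE SCALE TO FIRST-GRADIENT MASS LETTERS (sequel of `CoframeJetDipole`)

HONEST DEPENDENCY (page 1, mandatory): continuum YM on T⁴ ⇐ BetaPertH ∧ nine spine estimates (0/9 proved); BetaPertH ⇐ (D1) ∧ (D4) ∧
CAP+tail; G-an2-4 gates asym, D1 and NE2/3/4.  HONEST FRAMING (cell contract, verbatim): «discharging `BetaPertH` makes Bałaban's UV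
stability UNCONDITIONAL — a real constructive-QFT result; it is NOT the continuum limit and NOT the Clay problem.»  THIS FILE DISCHARGES
NOTHING of D1 / BetaPertH: [folklore] weighted `ℓ¹(ℤ⁴ × ℤ⁴)` bookkeeping over the road's OWN typed objects (`dSw`, `jetR`, `jetC`,
`tBw₁`, `Pgt`, `Rgt`, `Ggh`).  It proves NO estimate of Bałaban's and NO mass letter of any leg; it does NOT close (C1): it REDUCES the
displayed (C1) row of PART 14 (`RoadEndBFxRoadScalesS.d1Rep_BFx_road_scales_sbpS`, binders `hTs hTm`, OWNER d1-p2 g19 INTENT-7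
CLAIMS.log l.43964) at one scale `n` to FIRST-GRADIENT weighted mass letters of `Pgt n a`, `Rgt n a ∘ Ggh n a` (and its transpose),
`Rgt n a` — gan24-leaf-05's (γ)∕δ′ currency supplies them on `n = L^k`.  0∕4 row-D1 binders discharged; (K) NOT closed; NOT D1,
NOT BetaPertH, NOT continuum, NOT Clay.

WHAT IS HERE (unit `b2b-balaban-beta-d1-formalise-leaf-03`, gen 25, INTENT-1 «COFRAME-JET-DIPOLE» l.44044, part 2 of 2):
* §5 weighted `ℓ¹(Site × Site)` masses with the `u`-centred growth weight `e^{s(|p−u|₁+|q−u|₁)}`: ONE `dSw`-DIPOLE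
  (`dSw_dipole_weighted_mass_le`: `≤ 2·e^{s}·cA·rB` from the column-gradient letter of `A` and the row-gradient letter of `B` — one
  gradient per factor, `CoframeJetDipole.sum_abs_dSw_dipole_le`), ONE PINNED WORD (`jetR_weighted_mass_le` ∕ `jetC_weighted_mass_le`:
  `≤ e^{s}·rY`, `≤ e^{s}·cY`), and the COMBINATION RULE for `2•(c•(K₁ + K₂) + K₃ − K₄)`.
* §6 `tBw₁_eq_comb`: `tBw₁ n a κ u = 2•(n²•(dSw(dip P (G′R)) + dSw(dip (RG′) P)) + jetR κ u R − jetC κ u R)` (p329997's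
  `tBw₁_eq_projection` ∕ `wL_eq` ∕ `wR_eq` + part 1's dipole read-outs); **`tBw₁_weighted_mass_le`** (six letters):
  `Σ'_{(p,q)} Σ_{gf} |tBw₁ n a κ u p q g f|·e^{s(|p−u|₁+|q−u|₁)} ≤ 2·e^{s}·(2·n²·(cP·rGR + cRG·rP) + (rR + cR))`, summable — PART 14's
  `hTs hTm` summand character for character at `s := σV∕n`; **`tBw₁_weighted_mass_le_of_col`** (three letters, by the symmetries
  `Pᵀ = P`, `Rᵀ = R`, `(G′R)ᵀ = RG′`): `≤ 4·e^{s}·(2·n²·cP·cRG + cR)`.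
  LOCATED COUNT (not a theorem here): with `cP = O(π₁∕n)`, `cRG = O((g₁ + g·π₁)∕n)`, `cR = O(1)` at `s = σV∕n ≤ θ₀∕n` the bound is
  k-free on `n = L^k` — the `n²` of the legs stands against TWO first-gradient gains, one per factor; no second gradient, no log.

No `def`, no `def … : Prop`, nothing cited as mathematics.
-/

noncomputable section

namespace Summit.QuantumFields.BalabanUV.Beta.D1BFx.CoframeJetDipoleMass

open Literature.MathematicalPhysics.QuantumFieldTheory.Balaban1983to89
open Literature.MathematicalPhysics.QuantumFieldTheory.Balaban1983to89.Beta
open B12Sec2to5 (l1 l1_nonneg)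
open ExpKernelCalculus (Site MKer comp l1_sub_triangle l1_sub_symm)
open AffineAveraging (unitVec)
open KernelReflection (comp_smul_right)
open Summit.QuantumFields.BalabanUV.Beta.TameKernelCalculus (trK trK_apply trK_comp)
open Summit.QuantumFields.BalabanUV.Beta.D1BFx.GhostStencil (ghCur ghCur_apply l1_unitVec l1_zero)
open Summit.QuantumFields.BalabanUV.Beta.D1BFx.GhostStencilReflection (add_unitVec_ne_self)
open Summit.QuantumFields.BalabanUV.Beta.D1BFx.GhostStencilWard (comp_unit_apply comp_ghCur_apply ghCur_comp_apply)
open Summit.QuantumFields.BalabanUV.Beta.D1BFx.GhostLeg (Ggh trK_Ggh)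
open Summit.QuantumFields.BalabanUV.Beta.D1BFx.RProjector (Pgt)
open Summit.QuantumFields.BalabanUV.Beta.D1BFx.RJetProjector (Rgt)
open Summit.QuantumFields.BalabanUV.Beta.D1BFx.RProjectorJetLeibniz (trK_Pgt)
open Summit.QuantumFields.BalabanUV.Beta.D1BFx.TorusWeightWordTwisted (tBw₁)
open Summit.QuantumFields.BalabanUV.Beta.D1BFx.TorusJetSandwichArrays (jetR jetC jetR_apply jetC_apply)
open Summit.QuantumFields.BalabanUV.Beta.D1BFx.RJetAssembly (dSw dSw_apply)
open Summit.QuantumFields.BalabanUV.Beta.D1BFx.GluonNeedleSplit (dSw_add dSw_smul)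
open Summit.QuantumFields.BalabanUV.Beta.D1BFx.CoframeJetProjection (tBw₁_eq_projection wL_eq wR_eq trK_Rgt)

open Summit.QuantumFields.BalabanUV.Beta.D1BFx.CoframeJetDipole (comp_comp_ghCur_eq comp_ghCur_comp_eq sum_abs_dSw_dipole_le
  summable_and_tsum_le_of_le outer_summable_and_tsum_le recentre_self recentre_neighbour weight_self ind_summable_and_tsum_le
  sum_abs_jetR sum_abs_jetC)


variable (κ : Fin 4) (u : Site 4)

/-! ## §5 Weighted masses: one `dSw`-dipole, one pinned word, and the combination rule -/

/-- [folklore] **THE WEIGHTED MASS OF ONE `dSw`-DIPOLE ≤ `2·e^{s}·cA·rB`**: if every column of the row-gradient of `A` has `y`-centred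
weighted mass `≤ cA` and every row of the column-gradient of `B` has `x`-centred weighted mass `≤ rB` (rate `s ≥ 0`), then
`Σ'_{(p,q)} Σ_{αβ} |dSw(dip A B)(p,q,α,β)|·e^{s(|p−u|₁+|q−u|₁)} ≤ 2·e^{s}·(cA·rB)` — ONE gradient letter per factor. -/
theorem dSw_dipole_weighted_mass_le {A B : MKer 4 Unit} {s cA rB : ℝ} (hs : 0 ≤ s)
    (hA : ∀ y : Site 4, Summable (fun x => (∑ α, |A (x + unitVec α) y () () - A x y () ()|) * Real.exp (s * l1 (x - y))) ∧
      ∑' x, (∑ α, |A (x + unitVec α) y () () - A x y () ()|) * Real.exp (s * l1 (x - y)) ≤ cA)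
    (hB : ∀ x : Site 4, Summable (fun z => (∑ β, |B x (z + unitVec β) () () - B x z () ()|) * Real.exp (s * l1 (z - x))) ∧
      ∑' z, (∑ β, |B x (z + unitVec β) () () - B x z () ()|) * Real.exp (s * l1 (z - x)) ≤ rB) :
    (Summable fun pq : Site 4 × Site 4 => ∑ α, ∑ β,
      |dSw (fun x z _ _ => A x (u + unitVec κ) () () * B u z () () - A x u () () * B (u + unitVec κ) z () ()) pq.1 pq.2 α β|
        * Real.exp (s * (l1 (pq.1 - u) + l1 (pq.2 - u)))) ∧
    ∑' pq : Site 4 × Site 4, ∑ α, ∑ β,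
      |dSw (fun x z _ _ => A x (u + unitVec κ) () () * B u z () () - A x u () () * B (u + unitVec κ) z () ()) pq.1 pq.2 α β|
        * Real.exp (s * (l1 (pq.1 - u) + l1 (pq.2 - u))) ≤ 2 * Real.exp s * (cA * rB) := by
  have ha1 := recentre_neighbour κ u (fun x => Finset.sum_nonneg fun α _ => abs_nonneg _) hs (hA (u + unitVec κ))
  have ha0 := recentre_self u (fun x => Finset.sum_nonneg fun α _ => abs_nonneg _) hs (hA u)
  have hb0 := recentre_self u (fun z => Finset.sum_nonneg fun β _ => abs_nonneg _) hs (hB u)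
  have hb1 := recentre_neighbour κ u (fun z => Finset.sum_nonneg fun β _ => abs_nonneg _) hs (hB (u + unitVec κ))
  have hP1 := outer_summable_and_tsum_le (hf := ha1.1) (hg := hb0.1)
    (fun p => mul_nonneg (Finset.sum_nonneg fun _ _ => abs_nonneg _) (Real.exp_pos _).le)
    (fun q => mul_nonneg (Finset.sum_nonneg fun _ _ => abs_nonneg _) (Real.exp_pos _).le) ha1.2 hb0.2
  have hP2 := outer_summable_and_tsum_le (hf := ha0.1) (hg := hb1.1)
    (fun p => mul_nonneg (Finset.sum_nonneg fun _ _ => abs_nonneg _) (Real.exp_pos _).le)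
    (fun q => mul_nonneg (Finset.sum_nonneg fun _ _ => abs_nonneg _) (Real.exp_pos _).le) ha0.2 hb1.2
  refine summable_and_tsum_le_of_le (fun pq => Finset.sum_nonneg fun α _ => Finset.sum_nonneg fun β _ =>
    mul_nonneg (abs_nonneg _) (Real.exp_pos _).le) (fun pq => ?_) (hP1.1.add hP2.1) ?_
  · -- pointwise: `Σ|dSw| · W ≤ (ΣA₁·w)(ΣB₀·w) + (ΣA₀·w)(ΣB₁·w)`
    obtain ⟨p, q⟩ := pq
    simp only
    simp_rw [← Finset.sum_mul]
    rw [mul_add, Real.exp_add]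
    have h := sum_abs_dSw_dipole_le κ u A B p q
    have hw : 0 ≤ Real.exp (s * l1 (p - u)) * Real.exp (s * l1 (q - u)) := by positivity
    refine (mul_le_mul_of_nonneg_right h hw).trans (le_of_eq ?_)
    have e : ∀ a₁ b₀ a₀ b₁ wp wq : ℝ, (a₁ * b₀ + a₀ * b₁) * (wp * wq) = a₁ * wp * (b₀ * wq) + a₀ * wp * (b₁ * wq) := by
      intros; ring
    exact e _ _ _ _ _ _
  · rw [(hP1.1.tsum_add hP2.1)]
    have e : 2 * Real.exp s * (cA * rB) = Real.exp s * cA * rB + cA * (Real.exp s * rB) := by ring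
    rw [e]
    exact add_le_add hP1.2 hP2.2

/-- [folklore] **THE WEIGHTED MASS OF `jetR κ u Y` ≤ `e^{s}·rY`** (one pinned row at `u`, gradient along the row `u + e_κ` of `Y`). -/
theorem jetR_weighted_mass_le {Y : MKer 4 Unit} {s rY : ℝ} (hs : 0 ≤ s)
    (hYr : ∀ x : Site 4, Summable (fun z => (∑ β, |Y x (z + unitVec β) () () - Y x z () ()|) * Real.exp (s * l1 (z - x))) ∧
      ∑' z, (∑ β, |Y x (z + unitVec β) () () - Y x z () ()|) * Real.exp (s * l1 (z - x)) ≤ rY) :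
    (Summable fun pq : Site 4 × Site 4 => ∑ α, ∑ β, |jetR κ u Y pq.1 pq.2 α β| * Real.exp (s * (l1 (pq.1 - u) + l1 (pq.2 - u)))) ∧
    ∑' pq : Site 4 × Site 4, ∑ α, ∑ β, |jetR κ u Y pq.1 pq.2 α β| * Real.exp (s * (l1 (pq.1 - u) + l1 (pq.2 - u)))
      ≤ Real.exp s * rY := by
  have hyr := recentre_neighbour κ u (fun z => Finset.sum_nonneg fun β _ => abs_nonneg _) hs (hYr (u + unitVec κ))
  have hind := ind_summable_and_tsum_le u
  have hP := outer_summable_and_tsum_le (fun p => by positivity)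
    (fun q => mul_nonneg (Finset.sum_nonneg fun _ _ => abs_nonneg _) (Real.exp_pos _).le) hind.1 hyr.1 hind.2 hyr.2
  rw [one_mul] at hP
  refine summable_and_tsum_le_of_le (fun pq => Finset.sum_nonneg fun α _ => Finset.sum_nonneg fun β _ =>
    mul_nonneg (abs_nonneg _) (Real.exp_pos _).le) (fun pq => le_of_eq ?_) hP.1 hP.2
  obtain ⟨p, q⟩ := pq
  simp only
  simp_rw [← Finset.sum_mul]
  rw [sum_abs_jetR, mul_add, Real.exp_add]
  by_cases hp : p = u
  · rw [if_pos hp, hp, weight_self]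
    ring
  · rw [if_neg hp]
    ring

/-- [folklore] **THE WEIGHTED MASS OF `jetC κ u Y` ≤ `e^{s}·cY`** (one pinned column at `u`, gradient along the column `u + e_κ` of `Y`). -/
theorem jetC_weighted_mass_le {Y : MKer 4 Unit} {s cY : ℝ} (hs : 0 ≤ s)
    (hYc : ∀ y : Site 4, Summable (fun x => (∑ α, |Y (x + unitVec α) y () () - Y x y () ()|) * Real.exp (s * l1 (x - y))) ∧
      ∑' x, (∑ α, |Y (x + unitVec α) y () () - Y x y () ()|) * Real.exp (s * l1 (x - y)) ≤ cY) :
    (Summable fun pq : Site 4 × Site 4 => ∑ α, ∑ β, |jetC κ u Y pq.1 pq.2 α β| * Real.exp (s * (l1 (pq.1 - u) + l1 (pq.2 - u)))) ∧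
    ∑' pq : Site 4 × Site 4, ∑ α, ∑ β, |jetC κ u Y pq.1 pq.2 α β| * Real.exp (s * (l1 (pq.1 - u) + l1 (pq.2 - u)))
      ≤ Real.exp s * cY := by
  have hyc := recentre_neighbour κ u (fun x => Finset.sum_nonneg fun α _ => abs_nonneg _) hs (hYc (u + unitVec κ))
  have hind := ind_summable_and_tsum_le u
  have hP := outer_summable_and_tsum_le (fun p => mul_nonneg (Finset.sum_nonneg fun _ _ => abs_nonneg _) (Real.exp_pos _).le)
    (fun q => by positivity) hyc.1 hind.1 hyc.2 hind.2
  rw [mul_one] at hP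
  refine summable_and_tsum_le_of_le (fun pq => Finset.sum_nonneg fun α _ => Finset.sum_nonneg fun β _ =>
    mul_nonneg (abs_nonneg _) (Real.exp_pos _).le) (fun pq => le_of_eq ?_) hP.1 hP.2
  obtain ⟨p, q⟩ := pq
  simp only
  simp_rw [← Finset.sum_mul]
  rw [sum_abs_jetC, mul_add, Real.exp_add]
  by_cases hq : q = u
  · rw [if_pos hq, hq, weight_self]
    ring
  · rw [if_neg hq]
    ring

/-- [folklore] **THE COMBINATION RULE**: for bond kernels `K₁ K₂ K₃ K₄` with `u`-centred weighted masses `≤ m₁ m₂ m₃ m₄` and `c ≥ 0`,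
the kernel `2•(c•(K₁ + K₂) + K₃ − K₄)` has weighted mass `≤ 2·(c·(m₁ + m₂) + m₃ + m₄)`. -/
theorem comb_weighted_mass_le {K₁ K₂ K₃ K₄ : MKer 4 (Fin 4)} {c s m₁ m₂ m₃ m₄ : ℝ} (hc : 0 ≤ c)
    (h₁ : (Summable fun pq : Site 4 × Site 4 => ∑ α, ∑ β, |K₁ pq.1 pq.2 α β| * Real.exp (s * (l1 (pq.1 - u) + l1 (pq.2 - u)))) ∧
      ∑' pq : Site 4 × Site 4, ∑ α, ∑ β, |K₁ pq.1 pq.2 α β| * Real.exp (s * (l1 (pq.1 - u) + l1 (pq.2 - u))) ≤ m₁)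
    (h₂ : (Summable fun pq : Site 4 × Site 4 => ∑ α, ∑ β, |K₂ pq.1 pq.2 α β| * Real.exp (s * (l1 (pq.1 - u) + l1 (pq.2 - u)))) ∧
      ∑' pq : Site 4 × Site 4, ∑ α, ∑ β, |K₂ pq.1 pq.2 α β| * Real.exp (s * (l1 (pq.1 - u) + l1 (pq.2 - u))) ≤ m₂)
    (h₃ : (Summable fun pq : Site 4 × Site 4 => ∑ α, ∑ β, |K₃ pq.1 pq.2 α β| * Real.exp (s * (l1 (pq.1 - u) + l1 (pq.2 - u)))) ∧
      ∑' pq : Site 4 × Site 4, ∑ α, ∑ β, |K₃ pq.1 pq.2 α β| * Real.exp (s * (l1 (pq.1 - u) + l1 (pq.2 - u))) ≤ m₃)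
    (h₄ : (Summable fun pq : Site 4 × Site 4 => ∑ α, ∑ β, |K₄ pq.1 pq.2 α β| * Real.exp (s * (l1 (pq.1 - u) + l1 (pq.2 - u)))) ∧
      ∑' pq : Site 4 × Site 4, ∑ α, ∑ β, |K₄ pq.1 pq.2 α β| * Real.exp (s * (l1 (pq.1 - u) + l1 (pq.2 - u))) ≤ m₄) :
    (Summable fun pq : Site 4 × Site 4 => ∑ α, ∑ β,
      |((2 : ℝ) • (c • (K₁ + K₂) + K₃ - K₄)) pq.1 pq.2 α β| * Real.exp (s * (l1 (pq.1 - u) + l1 (pq.2 - u)))) ∧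
    ∑' pq : Site 4 × Site 4, ∑ α, ∑ β,
      |((2 : ℝ) • (c • (K₁ + K₂) + K₃ - K₄)) pq.1 pq.2 α β| * Real.exp (s * (l1 (pq.1 - u) + l1 (pq.2 - u)))
      ≤ 2 * (c * (m₁ + m₂) + m₃ + m₄) := by
  have hG : Summable fun pq : Site 4 × Site 4 =>
      2 * (c * ((∑ α, ∑ β, |K₁ pq.1 pq.2 α β| * Real.exp (s * (l1 (pq.1 - u) + l1 (pq.2 - u))))
                + ∑ α, ∑ β, |K₂ pq.1 pq.2 α β| * Real.exp (s * (l1 (pq.1 - u) + l1 (pq.2 - u))))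
           + (∑ α, ∑ β, |K₃ pq.1 pq.2 α β| * Real.exp (s * (l1 (pq.1 - u) + l1 (pq.2 - u))))
           + ∑ α, ∑ β, |K₄ pq.1 pq.2 α β| * Real.exp (s * (l1 (pq.1 - u) + l1 (pq.2 - u)))) :=
    ((((h₁.1.add h₂.1).mul_left c).add h₃.1).add h₄.1).mul_left 2
  refine summable_and_tsum_le_of_le (fun pq => Finset.sum_nonneg fun α _ => Finset.sum_nonneg fun β _ =>
    mul_nonneg (abs_nonneg _) (Real.exp_pos _).le) (fun pq => ?_) hG ?_
  · -- pointwise triangle inequality, then linearity of the finite fibre sums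
    have hw : 0 ≤ Real.exp (s * (l1 (pq.1 - u) + l1 (pq.2 - u))) := (Real.exp_pos _).le
    have hpt : ∀ α β, |((2 : ℝ) • (c • (K₁ + K₂) + K₃ - K₄)) pq.1 pq.2 α β| * Real.exp (s * (l1 (pq.1 - u) + l1 (pq.2 - u)))
        ≤ 2 * (c * (|K₁ pq.1 pq.2 α β| * Real.exp (s * (l1 (pq.1 - u) + l1 (pq.2 - u)))
                    + |K₂ pq.1 pq.2 α β| * Real.exp (s * (l1 (pq.1 - u) + l1 (pq.2 - u))))
               + |K₃ pq.1 pq.2 α β| * Real.exp (s * (l1 (pq.1 - u) + l1 (pq.2 - u)))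
               + |K₄ pq.1 pq.2 α β| * Real.exp (s * (l1 (pq.1 - u) + l1 (pq.2 - u)))) := by
      intro α β
      simp only [Pi.smul_apply, Pi.add_apply, Pi.sub_apply, smul_eq_mul]
      have h3 : |2 * (c * (K₁ pq.1 pq.2 α β + K₂ pq.1 pq.2 α β) + K₃ pq.1 pq.2 α β - K₄ pq.1 pq.2 α β)|
          ≤ 2 * (c * (|K₁ pq.1 pq.2 α β| + |K₂ pq.1 pq.2 α β|) + |K₃ pq.1 pq.2 α β| + |K₄ pq.1 pq.2 α β|) := by
        rw [abs_mul, abs_two]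
        refine mul_le_mul_of_nonneg_left ?_ zero_le_two
        calc |c * (K₁ pq.1 pq.2 α β + K₂ pq.1 pq.2 α β) + K₃ pq.1 pq.2 α β - K₄ pq.1 pq.2 α β|
            ≤ |c * (K₁ pq.1 pq.2 α β + K₂ pq.1 pq.2 α β) + K₃ pq.1 pq.2 α β| + |K₄ pq.1 pq.2 α β| := abs_sub _ _
          _ ≤ |c * (K₁ pq.1 pq.2 α β + K₂ pq.1 pq.2 α β)| + |K₃ pq.1 pq.2 α β| + |K₄ pq.1 pq.2 α β| := by
              gcongr; exact abs_add_le _ _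
          _ ≤ c * (|K₁ pq.1 pq.2 α β| + |K₂ pq.1 pq.2 α β|) + |K₃ pq.1 pq.2 α β| + |K₄ pq.1 pq.2 α β| := by
              gcongr; rw [abs_mul, abs_of_nonneg hc]; gcongr; exact abs_add_le _ _
      calc |2 * (c * (K₁ pq.1 pq.2 α β + K₂ pq.1 pq.2 α β) + K₃ pq.1 pq.2 α β - K₄ pq.1 pq.2 α β)|
              * Real.exp (s * (l1 (pq.1 - u) + l1 (pq.2 - u)))
          ≤ 2 * (c * (|K₁ pq.1 pq.2 α β| + |K₂ pq.1 pq.2 α β|) + |K₃ pq.1 pq.2 α β| + |K₄ pq.1 pq.2 α β|)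
              * Real.exp (s * (l1 (pq.1 - u) + l1 (pq.2 - u))) := mul_le_mul_of_nonneg_right h3 hw
        _ = _ := by ring
    refine (Finset.sum_le_sum fun α _ => Finset.sum_le_sum fun β _ => hpt α β).trans (le_of_eq ?_)
    simp only [Finset.mul_sum, Finset.sum_add_distrib, mul_add]
  · rw [tsum_mul_left, (((h₁.1.add h₂.1).mul_left c).add h₃.1).tsum_add h₄.1, ((h₁.1.add h₂.1).mul_left c).tsum_add h₃.1,
      tsum_mul_left, h₁.1.tsum_add h₂.1]
    have hc2 : (0 : ℝ) ≤ 2 := zero_le_two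
    nlinarith [h₁.2, h₂.2, h₃.2, h₄.2, mul_le_mul_of_nonneg_left (add_le_add h₁.2 h₂.2) hc]

/-! ## §6 The (C1) reduction: the END's twisted bond kernel against first-gradient letters -/

section CoframeJet

variable (n : ℕ) [NeZero n] (a : ℝ)

/-- [folklore] **THE TWISTED BOND KERNEL IN DIPOLE FORM**: `tBw₁ n a κ u = 2•(n²•(dSw(dip P (G′R)) + dSw(dip (RG′) P)) + jetR κ u R − jetC κ u R)`
(`P = Pgt n a`, `R = Rgt n a`, `G′ = Ggh n a`; from `CoframeJetProjection.tBw₁_eq_projection` ∕ `wL_eq` ∕ `wR_eq` and §1). -/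
theorem tBw₁_eq_comb (ha : 0 < a) :
    tBw₁ n a κ u = (2 : ℝ) • ((((n : ℝ) ^ 2)) • (
        dSw (fun x z _ _ => Pgt n a x (u + unitVec κ) () () * comp (Ggh n a) (Rgt n a) u z () ()
          - Pgt n a x u () () * comp (Ggh n a) (Rgt n a) (u + unitVec κ) z () ())
        + dSw (fun x z _ _ => comp (Rgt n a) (Ggh n a) x (u + unitVec κ) () () * Pgt n a u z () ()
          - comp (Rgt n a) (Ggh n a) x u () () * Pgt n a (u + unitVec κ) z () ()))
      + jetR κ u (Rgt n a) - jetC κ u (Rgt n a)) := by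
  rw [tBw₁_eq_projection n a κ u ha, wL_eq n a κ u ha, wR_eq n a κ u ha, comp_smul_right, KernelReflection.comp_smul_left, ← smul_add,
    dSw_smul,
    comp_ghCur_comp_eq, comp_comp_ghCur_eq, dSw_add]

/-- [folklore] **THE (C1) REDUCTION — SIX LETTERS**: at one scale `n`, rate `s ≥ 0`, if the column-gradient weighted masses of `Pgt n a`,
`Rgt n a ∘ Ggh n a`, `Rgt n a` are `≤ cP, cRG, cR` (weight centred at the column) and the row-gradient weighted masses of
`Ggh n a ∘ Rgt n a`, `Pgt n a`, `Rgt n a` are `≤ rGR, rP, rR` (weight centred at the row), then PART 14's (C1) summand is summable and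
`Σ'_{(p,q)} Σ_{gf} |tBw₁ n a κ u p q g f|·e^{s(|p−u|₁+|q−u|₁)} ≤ 2·e^{s}·(2·n²·(cP·rGR + cRG·rP) + (rR + cR))` — the `n²` of the legs
against TWO first-gradient letters, one per factor. -/
theorem tBw₁_weighted_mass_le (ha : 0 < a) {s cP rGR cRG rP rR cR : ℝ} (hs : 0 ≤ s)
    (hPc : ∀ y : Site 4, Summable (fun x => (∑ α, |Pgt n a (x + unitVec α) y () () - Pgt n a x y () ()|) * Real.exp (s * l1 (x - y))) ∧
      ∑' x, (∑ α, |Pgt n a (x + unitVec α) y () () - Pgt n a x y () ()|) * Real.exp (s * l1 (x - y)) ≤ cP)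
    (hGRr : ∀ x : Site 4, Summable (fun z => (∑ β, |comp (Ggh n a) (Rgt n a) x (z + unitVec β) () () - comp (Ggh n a) (Rgt n a) x z () ()|)
        * Real.exp (s * l1 (z - x))) ∧
      ∑' z, (∑ β, |comp (Ggh n a) (Rgt n a) x (z + unitVec β) () () - comp (Ggh n a) (Rgt n a) x z () ()|) * Real.exp (s * l1 (z - x))
        ≤ rGR)
    (hRGc : ∀ y : Site 4, Summable (fun x => (∑ α, |comp (Rgt n a) (Ggh n a) (x + unitVec α) y () () - comp (Rgt n a) (Ggh n a) x y () ()|)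
        * Real.exp (s * l1 (x - y))) ∧
      ∑' x, (∑ α, |comp (Rgt n a) (Ggh n a) (x + unitVec α) y () () - comp (Rgt n a) (Ggh n a) x y () ()|) * Real.exp (s * l1 (x - y))
        ≤ cRG)
    (hPr : ∀ x : Site 4, Summable (fun z => (∑ β, |Pgt n a x (z + unitVec β) () () - Pgt n a x z () ()|) * Real.exp (s * l1 (z - x))) ∧
      ∑' z, (∑ β, |Pgt n a x (z + unitVec β) () () - Pgt n a x z () ()|) * Real.exp (s * l1 (z - x)) ≤ rP)
    (hRr : ∀ x : Site 4, Summable (fun z => (∑ β, |Rgt n a x (z + unitVec β) () () - Rgt n a x z () ()|) * Real.exp (s * l1 (z - x))) ∧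
      ∑' z, (∑ β, |Rgt n a x (z + unitVec β) () () - Rgt n a x z () ()|) * Real.exp (s * l1 (z - x)) ≤ rR)
    (hRc : ∀ y : Site 4, Summable (fun x => (∑ α, |Rgt n a (x + unitVec α) y () () - Rgt n a x y () ()|) * Real.exp (s * l1 (x - y))) ∧
      ∑' x, (∑ α, |Rgt n a (x + unitVec α) y () () - Rgt n a x y () ()|) * Real.exp (s * l1 (x - y)) ≤ cR) :
    (Summable fun p : Site 4 × Site 4 => ∑ g, ∑ f, |tBw₁ n a κ u p.1 p.2 g f| * Real.exp (s * (l1 (p.1 - u) + l1 (p.2 - u)))) ∧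
    ∑' p : Site 4 × Site 4, ∑ g, ∑ f, |tBw₁ n a κ u p.1 p.2 g f| * Real.exp (s * (l1 (p.1 - u) + l1 (p.2 - u)))
      ≤ 2 * Real.exp s * (2 * (n : ℝ) ^ 2 * (cP * rGR + cRG * rP) + (rR + cR)) := by
  rw [tBw₁_eq_comb κ u n a ha]
  have h1 := dSw_dipole_weighted_mass_le κ u hs hPc hGRr
  have h2 := dSw_dipole_weighted_mass_le κ u hs hRGc hPr
  have h3 := jetR_weighted_mass_le κ u hs hRr
  have h4 := jetC_weighted_mass_le κ u hs hRc
  have h := comb_weighted_mass_le u (c := (n : ℝ) ^ 2) (by positivity) h1 h2 h3 h4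
  refine ⟨h.1, h.2.trans (le_of_eq ?_)⟩
  ring

/-- [folklore] The three symmetries that halve the letters: `P`, `R` are symmetric and `(G′∘R)ᵀ = R∘G′`, entrywise. -/
theorem comp_Ggh_Rgt_apply_swap (ha : 0 < a) (x z : Site 4) :
    comp (Ggh n a) (Rgt n a) x z () () = comp (Rgt n a) (Ggh n a) z x () () := by
  have e : trK (comp (Rgt n a) (Ggh n a)) = comp (Ggh n a) (Rgt n a) := by rw [trK_comp, trK_Ggh n a ha, trK_Rgt n a ha]
  rw [← e, trK_apply]

omit [NeZero n] in
/-- [folklore] `P` is symmetric, entrywise. -/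
theorem Pgt_apply_swap (ha : 0 < a) (x z : Site 4) : Pgt n a x z () () = Pgt n a z x () () := by
  conv_lhs => rw [← trK_Pgt n a ha, trK_apply]

omit [NeZero n] in
/-- [folklore] `R` is symmetric, entrywise. -/
theorem Rgt_apply_swap (ha : 0 < a) (x z : Site 4) : Rgt n a x z () () = Rgt n a z x () () := by
  conv_lhs => rw [← trK_Rgt n a ha, trK_apply]

/-- [folklore] **THE (C1) REDUCTION — THREE LETTERS** (the form gan24-leaf-05's `ColMass`-type letters feed): by the symmetries the row
letters equal the column letters, so from the column-gradient weighted masses `cP` (of `Pgt n a`), `cRG` (of `Rgt n a ∘ Ggh n a`) and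
`cR` (of `Rgt n a`) alone: `Σ'_{(p,q)} Σ_{gf} |tBw₁ n a κ u p q g f|·e^{s(|p−u|₁+|q−u|₁)} ≤ 4·e^{s}·(2·n²·cP·cRG + cR)`, summable.
LOCATED COUNT (not proved here): `cP = O(π₁∕n)`, `cRG = O((g₁ + g·π₁)∕n)`, `cR = O(1)` at `s ≤ θ₀∕n` ⟹ k-free on `n = L^k`. -/
theorem tBw₁_weighted_mass_le_of_col (ha : 0 < a) {s cP cRG cR : ℝ} (hs : 0 ≤ s)
    (hPc : ∀ y : Site 4, Summable (fun x => (∑ α, |Pgt n a (x + unitVec α) y () () - Pgt n a x y () ()|) * Real.exp (s * l1 (x - y))) ∧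
      ∑' x, (∑ α, |Pgt n a (x + unitVec α) y () () - Pgt n a x y () ()|) * Real.exp (s * l1 (x - y)) ≤ cP)
    (hRGc : ∀ y : Site 4, Summable (fun x => (∑ α, |comp (Rgt n a) (Ggh n a) (x + unitVec α) y () () - comp (Rgt n a) (Ggh n a) x y () ()|)
        * Real.exp (s * l1 (x - y))) ∧
      ∑' x, (∑ α, |comp (Rgt n a) (Ggh n a) (x + unitVec α) y () () - comp (Rgt n a) (Ggh n a) x y () ()|) * Real.exp (s * l1 (x - y))
        ≤ cRG)
    (hRc : ∀ y : Site 4, Summable (fun x => (∑ α, |Rgt n a (x + unitVec α) y () () - Rgt n a x y () ()|) * Real.exp (s * l1 (x - y))) ∧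
      ∑' x, (∑ α, |Rgt n a (x + unitVec α) y () () - Rgt n a x y () ()|) * Real.exp (s * l1 (x - y)) ≤ cR) :
    (Summable fun p : Site 4 × Site 4 => ∑ g, ∑ f, |tBw₁ n a κ u p.1 p.2 g f| * Real.exp (s * (l1 (p.1 - u) + l1 (p.2 - u)))) ∧
    ∑' p : Site 4 × Site 4, ∑ g, ∑ f, |tBw₁ n a κ u p.1 p.2 g f| * Real.exp (s * (l1 (p.1 - u) + l1 (p.2 - u)))
      ≤ 4 * Real.exp s * (2 * (n : ℝ) ^ 2 * (cP * cRG) + cR) := by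
  have hGRr : ∀ x : Site 4, Summable (fun z => (∑ β, |comp (Ggh n a) (Rgt n a) x (z + unitVec β) () ()
        - comp (Ggh n a) (Rgt n a) x z () ()|) * Real.exp (s * l1 (z - x))) ∧
      ∑' z, (∑ β, |comp (Ggh n a) (Rgt n a) x (z + unitVec β) () () - comp (Ggh n a) (Rgt n a) x z () ()|) * Real.exp (s * l1 (z - x))
        ≤ cRG := fun x => by
    simp_rw [comp_Ggh_Rgt_apply_swap n a ha x]
    exact hRGc x
  have hPr : ∀ x : Site 4, Summable (fun z => (∑ β, |Pgt n a x (z + unitVec β) () () - Pgt n a x z () ()|) * Real.exp (s * l1 (z - x))) ∧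
      ∑' z, (∑ β, |Pgt n a x (z + unitVec β) () () - Pgt n a x z () ()|) * Real.exp (s * l1 (z - x)) ≤ cP := fun x => by
    simp_rw [Pgt_apply_swap n a ha x]
    exact hPc x
  have hRr : ∀ x : Site 4, Summable (fun z => (∑ β, |Rgt n a x (z + unitVec β) () () - Rgt n a x z () ()|) * Real.exp (s * l1 (z - x))) ∧
      ∑' z, (∑ β, |Rgt n a x (z + unitVec β) () () - Rgt n a x z () ()|) * Real.exp (s * l1 (z - x)) ≤ cR := fun x => by
    simp_rw [Rgt_apply_swap n a ha x]
    exact hRc x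
  have h := tBw₁_weighted_mass_le κ u n a ha hs hPc hGRr hRGc hPr hRr hRc
  refine ⟨h.1, h.2.trans (le_of_eq ?_)⟩
  ring

end CoframeJet

end Summit.QuantumFields.BalabanUV.Beta.D1BFx.CoframeJetDipoleMass

end
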